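import Summits.AtomisticToContinuum.HydrodynamicLimit.Theses.BoxDissipativeWeakStrong
import HarnessLib

/-!
# Crux `FluxClosure` (stmt-AtomisticToContinuum-9902, route BoxDissipativeWeakStrong), line `registered`:
# the shift-average identity on the torus (entropy line for stub K, sub-goal S1)

Support file (`--supports stmt-AtomisticToContinuum-9902`) for the crux
`Summit.AtomisticToContinuum.HydrodynamicLimit.Theses.BoxDissipativeWeakStrong.FluxClosure`. The entropy line for the
kinetic stub K (relative-entropy local equilibrium ⇒ kinetic isotropy) needs a speed-`(N+1)` exponential-moment bound
of box functionals under local Gibbs laws; its proof writes the `x`-integral over `𝕋³` of a box functional as an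
AVERAGE OVER SHIFTS of SUMS OVER THE `m`-LATTICE `{k/m : k ∈ (Fin m)³} ⊆ 𝕋³`. This file proves that identity
(registered sub-goal `lintegral_eq_shiftAverage`): for `0 < m` and measurable `f : 𝕋³ → [0, ∞]`,

  `∫ f = ∫ₓ m⁻³ Σ_{k ∈ (Fin m)³} f (x + k/m) dx`.

Proof: the `lintegral` of the finite sum is the sum of the `lintegral`s (`lintegral_finsetSum`), each summand
`∫ₓ f (x + c) dx` equals `∫ f` by translation invariance of the Haar (= product Lebesgue) probability measure of the
compact abelian group `𝕋³ = (ℝ/ℤ)³` (`lintegral_add_right_eq_self`; the instance `IsAddRightInvariant volume` on the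
pi type is Mathlib's `MeasureTheory.Measure.pi.isAddRightInvariant`), the sum has `m³` equal terms
(`Fintype.card (Fin 3 → Fin m) = m ^ 3`), and `(m³)⁻¹ · (m³ · ∫ f) = ∫ f` in `ℝ≥0∞` (`m³ ≠ 0, ≠ ⊤`).
No definitions. References: standard (translation invariance of Haar measure, e.g. A. Deitmar, S. Echterhoff,
*Principles of Harmonic Analysis* (2014), §1.3).
-/

noncomputable section

namespace Summit.AtomisticToContinuum.HydrodynamicLimit.Theorems
namespace FluxClosureEnt

open scoped BigOperators Topology Classical MeasureTheory ProbabilityTheory InnerProductSpace ENNReal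
open Filter Set Function MeasureTheory ProbabilityTheory
open Literature.MathematicalPhysics.KineticTheory Literature.Analysis.FluidPDE Literature.Analysis.FunctionSpaces
open Summit.AtomisticToContinuum.HydrodynamicLimit.Theses.BoxDissipativeWeakStrong

/-- **Shift-average identity on the torus** (registered sub-goal S1 of the entropy line for stub K). For `0 < m` and
measurable `f : 𝕋³ → [0, ∞]`, the integral of `f` over `𝕋³` equals the integral of the average of `f` over the
`m³` lattice shifts `x ↦ x + k/m`, `k ∈ (Fin m)³`:
`∫ f = ∫ₓ (m³)⁻¹ Σ_k f (x + k/m) dx` (sum and constant out of the `lintegral`, translation invariance of Haar measure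
termwise, `m³` equal terms). [folklore] -/
theorem lintegral_eq_shiftAverage : ∀ (m : ℕ), 0 < m → ∀ (f : T3 → ℝ≥0∞), Measurable f → ∫⁻ x, f x = ∫⁻ x, ((m : ℝ≥0∞) ^ 3)⁻¹ * ∑ k : Fin 3 → Fin m, f (x + fun i => (((((k i : ℕ) : ℝ) / (m : ℝ)) : ℝ) : UnitAddCircle)) := by
  intro m hm f hf
  have hmeas : ∀ k : Fin 3 → Fin m,
      Measurable fun x : T3 => f (x + fun i => (((((k i : ℕ) : ℝ) / (m : ℝ)) : ℝ) : UnitAddCircle)) :=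
    fun k => hf.comp (measurable_add_const _)
  rw [lintegral_const_mul _ (Finset.measurable_sum _ fun k _ => hmeas k),
    lintegral_finsetSum _ fun k _ => hmeas k]
  simp only [lintegral_add_right_eq_self f]
  rw [Finset.sum_const, Finset.card_univ, Fintype.card_fun, Fintype.card_fin, Fintype.card_fin, nsmul_eq_mul,
    ← mul_assoc, Nat.cast_pow,
    ENNReal.inv_mul_cancel (pow_ne_zero 3 (Nat.cast_ne_zero.2 hm.ne')) (ENNReal.pow_ne_top (ENNReal.natCast_ne_top m)),
    one_mul]

end FluxClosureEnt
end Summit.AtomisticToContinuum.HydrodynamicLimit.Theorems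

end
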